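import Summits.Ventures.PackingBounds.ThreePointCert.T15d11Proof
import Summits.Ventures.PackingBounds.SphericalCodes.TammesReading

/-!
# Tammes problem, `N = 15`: `θ(15) < arccos(717/1250) = 54.998…°` (kernel-checked three-point bound)

Framing: lottery ticket; floor = certified bounds/negative ranges. Venture `PackingBounds`
(cell `pub-packcert`), spherical-codes family, table B2b (Tammes) row `N = 15`.

The kernel-checked Bachoc–Vallentin three-point certificate
`ThreePointCert.T15d11.tammes15_card_le_14_sdp` (`n = 3`, `s = 717/1250`, degree 11, Bachoc–Vallentin's
multiplier set, Chebyshev kernels on `S²`; exact bound value `14.976445 < 15`) says: every finite set of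
unit vectors of `ℝ³` with pairwise inner products `≤ 717/1250` has at most `14` elements. In Tammes form:
among any `15` or more points of `S²` two distinct ones make an angle `< arccos(717/1250) = 54.998…°`,
so `θ(15) < arccos(717/1250)`. Print record: Bachoc–Vallentin, ISIT 2007, Table 5.3 (degree 10):
`θ(15) ≤ 55.03°`; classical Fejes Tóth bound `56.67°`; best configuration known `53.6579…°`
(`Config.TammesConfigsA`). A certified bound, not a configuration and not an optimality claim.

## References
* C. Bachoc, F. Vallentin, J. Amer. Math. Soc. 21 (2008), Theorem 4.2. [`BachocVallentin2007`]
* C. Bachoc, F. Vallentin, Semidefinite programming, multivariate orthogonal polynomials, and codes in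
  spherical caps, Proc. ISIT 2007, Table 5.3.
-/

noncomputable section

open Finset
open scoped RealInnerProductSpace

namespace Summit.Ventures.PackingBounds.SphericalCodes

/-- **Tammes `N = 15`, inner products**: among any `15` or more unit vectors of `ℝ³`, two distinct ones
have inner product `> 717/1250`. -/
theorem tammes15_exists_inner_gt (C : Finset (EuclideanSpace ℝ (Fin 3)))
    (h1 : ∀ x ∈ C, ‖x‖ = 1) (hC : 14 < C.card) :
    ∃ x ∈ C, ∃ y ∈ C, x ≠ y ∧ (717 / 1250 : ℝ) < inner ℝ x y :=
  exists_inner_gt_of_codeBound ThreePointCert.T15d11.tammes15_card_le_14_sdp C h1 hC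

/-- **Tammes `N = 15`, angles**: among any `15` or more unit vectors of `ℝ³`, two distinct ones make an
(unoriented) angle `< arccos(717/1250)` (`= 54.998…°`; printed SDP bound `55.03°`, BV 2007 T5.3). -/
theorem tammes15_exists_angle_lt_arccos (C : Finset (EuclideanSpace ℝ (Fin 3)))
    (h1 : ∀ x ∈ C, ‖x‖ = 1) (hC : 14 < C.card) :
    ∃ x ∈ C, ∃ y ∈ C, x ≠ y ∧ InnerProductGeometry.angle x y < Real.arccos (717 / 1250) :=
  exists_angle_lt_arccos_of_codeBound ThreePointCert.T15d11.tammes15_card_le_14_sdp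
    (by norm_num) C h1 hC

/-- **`θ(15) < arccos(717/1250)`**: any common lower bound `θ` for the pairwise angles of `15` or more
unit vectors of `ℝ³` satisfies `θ < arccos(717/1250)`. -/
theorem tammes15_minAngle_lt_arccos (C : Finset (EuclideanSpace ℝ (Fin 3)))
    (h1 : ∀ x ∈ C, ‖x‖ = 1) (hC : 14 < C.card) (θ : ℝ)
    (hθ : ∀ x ∈ C, ∀ y ∈ C, x ≠ y → θ ≤ InnerProductGeometry.angle x y) :
    θ < Real.arccos (717 / 1250) :=
  minAngle_lt_arccos_of_codeBound ThreePointCert.T15d11.tammes15_card_le_14_sdp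
    (by norm_num) C h1 hC θ hθ

end Summit.Ventures.PackingBounds.SphericalCodes

end
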